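import Summits.NavierStokesRegularity.FunctionalMining.NoGo.StrainMomentLtTwoReg
import HarnessLib

/-!
# FunctionalMining / NoGo — K11d (4/4): THE HEAT ROW OF `Z_q` FOR EVERY REAL `1 < q < 2` —
# `HeatCoercive Z_q (2π²q(q−1)/(51(2−q/2)²))` PROVED, field form, no weighted dissipation at `ε = 0`

HONEST FRAMING. Search for candidate a priori estimates; no regularity claim. Nothing about
Navier–Stokes is proved or asserted in this file: inequalities for smooth vector fields on the
flat torus along the HEAT line `v + tΔv` (no transport term, no pressure) and lemmas of real
analysis. Cell `pub-nsfunc`, no-go seat (gen 39). K11 = FOUR files, imported in this order: K11a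
`NoGo/StrainMomentLtTwoRadial` → K11b `NoGo/StrainMomentLtTwoLine` → K11c `NoGo/StrainMomentLtTwoReg`
→ K11d `NoGo/StrainMomentHeatCoerciveLtTwo` (the row); K12 = `NoGo/TopBotEigHeatCoerciveLtTwo`.

THE TARGET (K11d). The tree proves the heat row of the strain moment `Z_q = torusStrainMoment q =
∫|S|^q` — `TopEig.HeatCoercive Z_q c`: `c·Z_q(v) ≤ heatDissipation Z_q v = −(d/dt)⁺Z_q(v+tΔv)|₀` on
smooth divergence-free `v` — for real `q > 2` (`TopEigStrainHeatLine`, through the weighted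
dissipation `D_Z = ∫|S|^{q−2}|∇S|²` and `npConst q`) and at `q = 2` (K7/K8). BELOW `q = 2` the weight
`|S|^{q−2}` is singular on `{S = 0}` and no `D_Z` is available; K11 proves the row for EVERY REAL
`1 < q < 2` without ever forming a weighted dissipation at `ε = 0`:
`TopEig.strainMoment_heatCoercive_of_lt_two (hq1 : 1 < q) (hq2 : q < 2) : HeatCoercive Z_q (c_Z q)`,
`c_Z q = TopEig.zqRateLtTwo q = 2π²q(q−1)/(51(2−q/2)²)` (not sharp), in FIELD FORM (every smooth `v`).
K12 re-runs K9's mixture principle with this row: `TopBotEigSplitting q c → 0 < c →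
TopBotEigHeatCoercivePos q` for `1 < q < 2` (door D-K6 (c) below `q = 2` REDUCED to the splitting, which
is NOT proved below `q = 2`).

THE ARGUMENT. `b = q/2 − 1 ∈ (−1/2, 0)`, `S = strainFlat v`, `B = strainFlat(Δv)`. (1) [K11a/b] the
tangent inequality `(|x+τy|²)^{q/2} − (|x|²)^{q/2} ≤ τ·q(|x+τy|²)^b⟨x+τy, y⟩` holds for EVERY real
`q > 1` with Lean's `0`-conventions, so `Z_q(v+τΔv) − Z_q(v) ≤ τψ(τ)` (`ψ = strainLinePairing`,
continuous in `τ` since `z ↦ (|z|²)^b z` is continuous for `b > −1/2`). (2) [K11c] regularise ONLY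
inside the sign lemma and the Poincaré step, `ε = η²`: `F(η) = ∫(|S|²+η²)^b⟨S,B⟩ ≤ −(q−1)·G(η)`,
`G(η) = ∫(|S|²+η²)^bΣ(∂ₖSᵢⱼ)²` (integration by parts + Kato, keeping the `p`-Laplacian factor
`q − 1`), and `Z_q ≤ 204·E(η) + (51/(2π²))(2−q/2)²·G(η)`, `E(η) = ∫‖W_{η²} − W‖²`,
`W = (|S|²)^{b/2}S`, `Z_q = ∫‖W‖²` (mean control `‖∫W‖ ≤ 4‖W − ∫W‖₂` as `S = ‖W‖^γW`,
`γ = −b/(1+b) ∈ (0,1)`, has zero mean; K8's SHARP Poincaré–Wirtinger; `‖∂ₖW_ε‖ ≤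
(1+|b|)(|S|²+ε)^{b/2}‖∂ₖS‖`). (3) [here] `E`, `F` are parametric integrals of jointly continuous
integrands, `E(0) = 0`, `ψ(0) = q·F(0)`: `η → 0⁺` gives `ψ(0) ≤ −c_Z(q)·Z_q`; convexity of
`t ↦ Z_q(v+tΔv)` (tree, `q ≥ 1`) turns the secant bound into the right-derivative bound.

WHAT IS PROVED HERE [ours], on `T³`:
* the rate `TopEig.zqRateLtTwo q = 2π²q(q−1)/(51(2−q/2)²)` (`> 0` for `1 < q < 4`) and the limit lemma
  `TopEig.const_le_of_forall_pos_le`;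
* the SIGN LEMMA **`TopEig.strainLinePairing_laplacian_zero_le_of_lt_two (hq1 : 1 < q) (hq2 : q < 2) :
  ψ(0) ≤ −c_Z(q)·Z_q(v)`** (`w = Δv`, every smooth `v`);
* the field-form row **`TopEig.strainMoment_heatDissipation_ge_of_lt_two : c_Z(q)·Z_q(v) ≤
  heatDissipation Z_q v`** for EVERY smooth `v` (neither `div v = 0` nor zero mean is used), and
  **`TopEig.strainMoment_heatCoercive_of_lt_two (hq1 : 1 < q) (hq2 : q < 2) :
  HeatCoercive (d := Fin 3) (torusStrainMoment q) (zqRateLtTwo q)`**.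

WHAT IS NOT PROVED HERE. No sharp constant (as `q → 2⁻` the rate tends to `4π²/51`, far below the
single-shell value `8π²` at `q = 2`); nothing at `q ≤ 1`; the symmetrised core is K12; nothing here
bears on door D-K6 (b) (`3/2 < q < 2`, the sign of the stretching), which stays OPEN both ways.

PROVENANCE / STATUS. Typed and farm-checked by the no-go seat (gen 39): K11a stand-alone, the others as
concatenations with the union of their tree imports (evidence `pub-nsfunc-nogo/sieveld/kth/`: check
JSONs, a negative control, the by-value file `zqRateLtTwo (3/2) = 8π²/425`). STATUS: STAGED
(`pub-nsfunc-nogo/NoGo/<name>.STAGING.lean`); filing by a prove seat on the lead's word in the order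
K11a → K11b → K11c → K11d → K12, after K8 `NoGo/TopBotEigHeatCoerciveTwoSharp` and K9
`NoGo/TopBotEigHeatCoerciveSplit` (both in the tree); the planner seat cannot file under
`FunctionalMining/`. No constant is claimed sharp. Search for candidate a priori estimates; no
regularity claim. [ours; K1-Q6 = door D-K6, heat side, `1 < q < 2`]
FILING (prove seat g26, REQUEST #25d): declarations byte-identical to the no-go seat's staged `StrainMomentHeatCoerciveLtTwo.STAGING.lean` fc955c1e9cf9c491; this line is the only addition.
-/

noncomputable section

open MeasureTheory Finset Set Filter Topology
open scoped InnerProductSpace RealInnerProductSpace ContDiff Real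

namespace Summit.NavierStokesRegularity.FunctionalMining

open Literature.Analysis.FunctionSpaces Literature.Analysis.FunctionSpaces.Torus
  Literature.Analysis.FluidPDE

namespace TopEig

open StrainL4 StrainMoment

/-! ## 8. Heat coercivity of `Z_q`, `1 < q < 2` -/

/-- The heat-coercivity rate of `Z_q` below `q = 2`:
`c_Z(q) = 2π² q (q − 1) / (51 (2 − q/2)²)`. [ours, bookkeeping] -/
def zqRateLtTwo (q : ℝ) : ℝ := 2 * π ^ 2 * q * (q - 1) / (51 * (2 - q / 2) ^ 2)

/-- `c_Z(q) > 0` for `1 < q < 4`. [ours, bookkeeping] -/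
theorem zqRateLtTwo_pos {q : ℝ} (hq1 : 1 < q) (hq4 : q < 4) : 0 < zqRateLtTwo q := by
  unfold zqRateLtTwo
  have h1 : 0 < 2 - q / 2 := by linarith
  have h2 : 0 < q - 1 := by linarith
  positivity

/-- Passing to `η → 0⁺` in `A ≤ B η` (`0 < η ≤ 1`) with `B` continuous at `0`. [folklore] -/
theorem const_le_of_forall_pos_le {A : ℝ} {B : ℝ → ℝ} (hB : ContinuousAt B 0)
    (h : ∀ η : ℝ, 0 < η → η ≤ 1 → A ≤ B η) : A ≤ B 0 := by
  have ht : Tendsto B (𝓝[>] 0) (𝓝 (B 0)) := hB.tendsto.mono_left nhdsWithin_le_nhds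
  refine ge_of_tendsto ht ?_
  have hmem : Ioo (0 : ℝ) 1 ∈ 𝓝[>] (0 : ℝ) := Ioo_mem_nhdsGT one_pos
  filter_upwards [hmem] with η hη using h η hη.1 hη.2.le

/-- **The sign lemma for the pairing at `τ = 0` along the heat line, below `q = 2`**: for
`1 < q < 2` and every smooth `v` on `T³`, `ψ(0) ≤ −c_Z(q) Z_q(v)`. With `b = q/2 − 1`,
`F(η) = ∫ (|S|²+η²)^b ⟨S, S(Δv)⟩`, `G(η) = ∫ (|S|²+η²)^b |∇S|²`, `E(η) = ∫‖W_{η²} − W‖²`: for `η > 0`,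
`F(η) ≤ −(q−1) G(η)` (`integral_reg_strain_laplacian_le`) and
`Z_q ≤ 204 E(η) + (51/(2π²))(2 − q/2)² G(η)` (`strainMoment_le_reg_of_lt_two`); `E`, `F` are
parametric integrals of jointly continuous integrands (`continuous_rpow_normSq_add_sq_smul`), `E(0) = 0`
and `ψ(0) = q F(0)`; let `η → 0⁺`. No weighted dissipation at `ε = 0` is ever formed. [ours] -/
theorem strainLinePairing_laplacian_zero_le_of_lt_two {q : ℝ} (hq1 : 1 < q) (hq2 : q < 2)
    {v : UnitAddTorus (Fin 3) → EuclideanSpace ℝ (Fin 3)} (hv : Torus.IsSmooth v) :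
    strainLinePairing q v (Torus.laplacian v) 0 ≤ -(zqRateLtTwo q * torusStrainMoment q v) := by
  obtain ⟨b, hb⟩ : ∃ b : ℝ, b = q / 2 - 1 := ⟨_, rfl⟩
  have hb1 : -1 / 2 < b := by rw [hb]; linarith
  have hb3 : -1 / 2 < b / 2 := by rw [hb]; linarith
  have hΔ : Torus.IsSmooth (Torus.laplacian v) := hv.laplacian
  set S : UnitAddTorus (Fin 3) → EuclideanSpace ℝ (Fin 3 × Fin 3) := strainFlat v with hSdef
  set B : UnitAddTorus (Fin 3) → EuclideanSpace ℝ (Fin 3 × Fin 3) := strainFlat (Torus.laplacian v)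
    with hBdef
  have hSc : Continuous S := continuous_strainFlat hv
  have hBc : Continuous B := continuous_strainFlat hΔ
  obtain ⟨K, hK⟩ : ∃ K : ℝ, K = 51 / (2 * π ^ 2) * (2 - q / 2) ^ 2 := ⟨_, rfl⟩
  have hK0 : 0 < K := by
    rw [hK]
    have : 0 < 2 - q / 2 := by linarith
    positivity
  -- the three parametric quantities
  set F : ℝ → ℝ := fun η => ∫ x, (‖S x‖ ^ 2 + η ^ 2) ^ b * ⟪S x, B x⟫_ℝ with hF
  set E : ℝ → ℝ := fun η => ∫ x, ‖(‖S x‖ ^ 2 + η ^ 2) ^ (b / 2) • S x -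
    (‖S x‖ ^ 2) ^ (b / 2) • S x‖ ^ 2 with hE
  -- `ψ(0) = q F(0)`
  have hψ0 : strainLinePairing q v (Torus.laplacian v) 0 = q * F 0 := by
    unfold strainLinePairing
    rw [← integral_const_mul]
    refine integral_congr_ae (ae_of_all _ fun x => ?_)
    show q * (‖strainFlat v x + (0 : ℝ) • strainFlat (Torus.laplacian v) x‖ ^ 2) ^ (q / 2 - 1) *
        ⟪strainFlat v x + (0 : ℝ) • strainFlat (Torus.laplacian v) x,
          strainFlat (Torus.laplacian v) x⟫_ℝ =
      q * ((‖S x‖ ^ 2 + (0 : ℝ) ^ 2) ^ b * ⟪S x, B x⟫_ℝ)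
    rw [zero_smul, add_zero, hb]
    simp only [hSdef, hBdef]
    ring_nf
  -- the inequality for every `0 < η ≤ 1`
  have hineq : ∀ η : ℝ, 0 < η → η ≤ 1 →
      (q - 1) * torusStrainMoment q v ≤ 204 * (q - 1) * E η + K * (-F η) := by
    intro η hη _
    have hε : 0 < η ^ 2 := by positivity
    have hNP := strainMoment_le_reg_of_lt_two hq1 hq2 hv hε
    have hsg := integral_reg_strain_laplacian_le hv hε hq1.le hq2.le
    -- identify the terms
    have eF : F η = ∫ x, (torusStrainSqAt v x + η ^ 2) ^ (q / 2 - 1) * ∑ i, ∑ j,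
        (Torus.partialDeriv j v x i + Torus.partialDeriv i v x j) / 2 *
          Torus.partialDeriv i (Torus.laplacian v) x j := by
      refine integral_congr_ae (ae_of_all _ fun x => ?_)
      show (‖S x‖ ^ 2 + η ^ 2) ^ b * ⟪S x, B x⟫_ℝ = _
      rw [hSdef, hBdef, norm_strainFlat_sq, inner_strainFlat_laplacian, hb]
    have eE : E η = ∫ x, ‖(‖strainFlat v x‖ ^ 2 + η ^ 2) ^ ((q / 2 - 1) / 2) • strainFlat v x -
        (‖strainFlat v x‖ ^ 2) ^ ((q / 2 - 1) / 2) • strainFlat v x‖ ^ 2 := by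
      simp only [hE, hSdef, hb]
    rw [← eF] at hsg
    rw [← eE, ← hK] at hNP
    have hq10 : 0 ≤ q - 1 := by linarith
    have h1 := mul_le_mul_of_nonneg_left hNP hq10
    have h2 : (q - 1) * (K * ∫ x, (torusStrainSqAt v x + η ^ 2) ^ (q / 2 - 1) *
        ∑ k, ∑ i, ∑ j, ((Torus.partialDeriv k (Torus.partialDeriv j v) x i +
          Torus.partialDeriv k (Torus.partialDeriv i v) x j) / 2) ^ 2) ≤ K * (-F η) := by
      rw [← mul_assoc, mul_comm (q - 1) K, mul_assoc]
      exact mul_le_mul_of_nonneg_left (by linarith) hK0.le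
    linarith
  -- continuity of `E` and `F`
  have hpair : Continuous fun p : ℝ × UnitAddTorus (Fin 3) => (p.1, S p.2) :=
    continuous_fst.prodMk (hSc.comp continuous_snd)
  have hPc := (continuous_rpow_normSq_add_sq_smul
    (E := EuclideanSpace ℝ (Fin 3 × Fin 3)) hb1).comp hpair
  have hP2c := (continuous_rpow_normSq_add_sq_smul
    (E := EuclideanSpace ℝ (Fin 3 × Fin 3)) hb3).comp hpair
  have hsnd : Continuous fun p : ℝ × UnitAddTorus (Fin 3) => S p.2 := hSc.comp continuous_snd
  have hP0c := (continuous_rpow_normSq_smul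
    (E := EuclideanSpace ℝ (Fin 3 × Fin 3)) hb3).comp hsnd
  have hFc : Continuous F := by
    have hI : Continuous (Function.uncurry fun (η : ℝ) (x : UnitAddTorus (Fin 3)) =>
        (‖S x‖ ^ 2 + η ^ 2) ^ b * ⟪S x, B x⟫_ℝ) := by
      have hBsnd : Continuous fun p : ℝ × UnitAddTorus (Fin 3) => B p.2 := hBc.comp continuous_snd
      refine (hPc.inner hBsnd).congr fun p => ?_
      rcases p with ⟨η, x⟩
      simp only [Function.uncurry_apply_pair, Function.comp_apply, real_inner_smul_left]
    have h := continuous_parametric_integral_of_continuous (μ := volume) hI isCompact_univ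
    simpa only [Measure.restrict_univ] using h
  have hEc : Continuous E := by
    have hI : Continuous (Function.uncurry fun (η : ℝ) (x : UnitAddTorus (Fin 3)) =>
        ‖(‖S x‖ ^ 2 + η ^ 2) ^ (b / 2) • S x - (‖S x‖ ^ 2) ^ (b / 2) • S x‖ ^ 2) := by
      refine ((hP2c.sub hP0c).norm.pow 2).congr fun p => ?_
      rcases p with ⟨η, x⟩
      simp only [Function.uncurry_apply_pair, Pi.pow_apply, Pi.sub_apply, Function.comp_apply]
    have h := continuous_parametric_integral_of_continuous (μ := volume) hI isCompact_univ
    simpa only [Measure.restrict_univ] using h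
  have hE0 : E 0 = 0 := by
    show (∫ x, ‖(‖S x‖ ^ 2 + (0 : ℝ) ^ 2) ^ (b / 2) • S x - (‖S x‖ ^ 2) ^ (b / 2) • S x‖ ^ 2) = 0
    refine (integral_congr_ae (ae_of_all _ fun x => ?_)).trans (integral_zero _ _)
    simp
  -- `η → 0⁺`
  have hBc0 : ContinuousAt (fun η => 204 * (q - 1) * E η + K * (-F η)) 0 :=
    ((hEc.continuousAt.const_mul _).add ((hFc.continuousAt.neg).const_mul K))
  have hlim := const_le_of_forall_pos_le hBc0 hineq
  simp only [hE0, mul_zero, zero_add] at hlim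
  -- `ψ(0) = q F(0) ≤ −q (q−1) Z_q / K = −c_Z Z_q`
  have hF0 : F 0 ≤ -((q - 1) * torusStrainMoment q v) / K := by
    rw [le_div_iff₀ hK0]; linarith
  have hrate : zqRateLtTwo q = q * (q - 1) / K := by
    rw [hK]; unfold zqRateLtTwo
    have : 0 < 2 - q / 2 := by linarith
    field_simp
  rw [hψ0, hrate]
  have hq0 : 0 < q := by linarith
  calc q * F 0 ≤ q * (-((q - 1) * torusStrainMoment q v) / K) := mul_le_mul_of_nonneg_left hF0 hq0.le
    _ = -(q * (q - 1) / K * torusStrainMoment q v) := by field_simp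

/-- **Heat coercivity of `Z_q` below `q = 2`, field form**: for `1 < q < 2` and every smooth `v` on
`T³`, `c_Z(q) Z_q(v) ≤ heatDissipation Z_q v` (no divergence-free or zero-mean hypothesis is used).
[ours] -/
theorem strainMoment_heatDissipation_ge_of_lt_two {q : ℝ} (hq1 : 1 < q) (hq2 : q < 2)
    {v : UnitAddTorus (Fin 3) → EuclideanSpace ℝ (Fin 3)} (hv : Torus.IsSmooth v) :
    zqRateLtTwo q * torusStrainMoment q v ≤ heatDissipation (torusStrainMoment q) v := by
  have hq1' : (1 : ℝ) ≤ q := hq1.le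
  have hΔ : Torus.IsSmooth (Torus.laplacian v) := hv.laplacian
  have hZcvx : ConvexOn ℝ univ (fun t : ℝ => torusStrainMoment q (v + t • Torus.laplacian v)) :=
    convexOn_strainMoment_line hq1' hv hΔ
  obtain ⟨hder, heq⟩ := heatDissipation_eq_neg_rightDeriv (d := Fin 3)
    (Φ := torusStrainMoment q) (v := v) hZcvx
  rw [heq]
  set D := derivWithin (fun t : ℝ => torusStrainMoment q (v + t • Torus.laplacian v)) (Set.Ioi 0) 0
    with hD
  have ht := (hasDerivWithinAt_iff_tendsto_slope' self_notMem_Ioi).mp hder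
  set ψ := strainLinePairing q v (Torus.laplacian v) with hψ
  have hψc : Continuous ψ := continuous_strainLinePairing_of_one_lt hq1 hv hΔ
  have hev : ∀ᶠ τ in 𝓝[>] (0 : ℝ),
      slope (fun t : ℝ => torusStrainMoment q (v + t • Torus.laplacian v)) 0 τ ≤ ψ τ := by
    filter_upwards [self_mem_nhdsWithin] with τ (hτ : 0 < τ)
    have hZ : torusStrainMoment q (v + τ • Torus.laplacian v) - torusStrainMoment q v ≤ τ * ψ τ :=
      strainMoment_line_sub_le_of_one_lt hq1 hv hΔ τ
    rw [slope_def_field, sub_zero]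
    simp only [zero_smul, add_zero]
    rw [div_le_iff₀ hτ]
    linarith
  have hlim : Tendsto ψ (𝓝[>] (0 : ℝ)) (𝓝 (ψ 0)) := (hψc.tendsto 0).mono_left nhdsWithin_le_nhds
  have hDle : D ≤ ψ 0 := le_of_tendsto_of_tendsto ht hlim hev
  have hψ0 : ψ 0 ≤ -(zqRateLtTwo q * torusStrainMoment q v) :=
    strainLinePairing_laplacian_zero_le_of_lt_two hq1 hq2 hv
  linarith

/-- **The `Z_q` heat row below `q = 2`**: for `1 < q < 2`,
`HeatCoercive Z_q (2π² q (q−1) / (51 (2 − q/2)²))` on `T³`. Search for candidate a priori estimates;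
no regularity claim. [ours] -/
theorem strainMoment_heatCoercive_of_lt_two {q : ℝ} (hq1 : 1 < q) (hq2 : q < 2) :
    HeatCoercive (d := Fin 3) (torusStrainMoment q) (zqRateLtTwo q) :=
  fun _ _ hv _ _ => strainMoment_heatDissipation_ge_of_lt_two hq1 hq2 hv

end TopEig

end Summit.NavierStokesRegularity.FunctionalMining
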